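import Summits.RiemannHypothesis.RiemannHypothesis.Theorems.SuzukiKernelThetaDeriv

/-!
# The prime part of the `θ`-flow generator acts by prime shifts: `(2π)⁻¹∫ (ΣΛ(n)n^{-s}) Θ_θ e^{−izx} = Σ Λ(n) n^{-1/2} K_θ(x − log n)` (column DBR; RH-FREE)

RH-FREE throughout; nothing here bears on the truth of RH.

First piece of the decomposition `J_θ = k ∗ K_θ` behind `FlowPairing` (`Theorems.SuzukiThetaFlowDefs`): the generator of
the `θ`-flow is `L(z) = −2ξ'/ξ(s)`, `s = ½ − iz`, and on `Re s > 1`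
`ξ'/ξ(s) = 1/s + 1/(s−1) − ½log π + ½ψ(s/2) − Σ Λ(n) n^{−s}` (`logDeriv_riemannXi_eq_of_one_lt_re`).  The PRIME PART
`2 Σ Λ(n) n^{−s}` is a Dirichlet series in `n^{iz}`, and multiplication of the symbol by `n^{iz} = e^{iz log n}` is the
SHIFT `x ↦ x − log n` of the inverse transform along any line:

* `invFourierLine_cexp_mul_shift` — `invFourierLine (z ↦ e^{iza} Φ(z)) c x = invFourierLine Φ c (x − a)`;
* `term_vonMangoldt_half_sub_eq` — on `Im z = 1`: `Λ(n) n^{−(½ − iz)} = Λ(n) n^{−1/2} · e^{iz log n}` (`n ≥ 1`);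
* **`invFourierLine_vonMangoldt_mul_limTheta`** — for `θ > 1` and real `x`:
  `invFourierLine (z ↦ L(Λ, ½ − iz) · Θ_θ(z)) 1 x = Σ' n, Λ(n) n^{−1/2} · invFourierLine Θ_θ 1 (x − log n)`
  (absolute convergence: `|n^{−s}| = n^{−3/2}` on the line, `Σ Λ(n) n^{−3/2} < ∞`, `∫|Θ_θ(u+i)| < ∞`; the swap is
  `integral_tsum_of_summable_integral_norm`);
* `re_invFourierLine_vonMangoldt_mul_limTheta` — real parts: `= Σ' n, Λ(n) n^{−1/2} K_θ(x − log n)`, a FINITE sum in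
  effect (`K_θ(x − log n) = 0` for `log n ≥ x`, [Su20] (K-iii)).

So the prime part of `𝒥_θ[t]` is `f ↦ −2·2 Σ_{n} Λ(n)n^{-1/2} (𝖪_θ f)(· − log n)`-type prime shifts — the source of the
`weilPrimeTerm` in `FlowPairing`.  References: [Su20] M. Suzuki, ASPM 84 (2020) = arXiv:1907.07302, (1.9)–(1.12).
-/

noncomputable section

-- D-0017: `Summit.<S>.<S>.…` is the designed namespace of a single-problem summit.
set_option linter.dupNamespace false

open Complex MeasureTheory Filter Topology Set LSeries
open scoped LSeries.notation ArithmeticFunction.vonMangoldt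

namespace Summit.RiemannHypothesis.RiemannHypothesis.Theorems.SuzukiKernelSemigroup

open Literature.NumberTheory.LFunctions

/-! ## §1 The shift rule -/

/-- RH-FREE.  Multiplying the symbol by `e^{iza}` shifts the inverse line transform by `a`:
`invFourierLine (z ↦ e^{iza} Φ(z)) c x = invFourierLine Φ c (x − a)`. -/
theorem invFourierLine_cexp_mul_shift (Φ : ℂ → ℂ) (c a x : ℝ) :
    invFourierLine (fun z : ℂ => Complex.exp (I * z * (a : ℂ)) * Φ z) c x = invFourierLine Φ c (x - a) := by
  unfold invFourierLine
  congr 1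
  refine integral_congr_ae (Eventually.of_forall fun u => ?_)
  have e : Complex.exp (I * ((u : ℂ) + (c : ℂ) * I) * (a : ℂ)) *
      Complex.exp (-I * ((u : ℂ) + (c : ℂ) * I) * (x : ℂ)) =
      Complex.exp (-I * ((u : ℂ) + (c : ℂ) * I) * ((x - a : ℝ) : ℂ)) := by
    rw [← Complex.exp_add]
    congr 1
    push_cast
    ring
  calc Complex.exp (I * ((u : ℂ) + (c : ℂ) * I) * (a : ℂ)) * Φ ((u : ℂ) + (c : ℂ) * I) *
        Complex.exp (-I * ((u : ℂ) + (c : ℂ) * I) * (x : ℂ))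
      = Φ ((u : ℂ) + (c : ℂ) * I) * (Complex.exp (I * ((u : ℂ) + (c : ℂ) * I) * (a : ℂ)) *
          Complex.exp (-I * ((u : ℂ) + (c : ℂ) * I) * (x : ℂ))) := by ring
    _ = Φ ((u : ℂ) + (c : ℂ) * I) * Complex.exp (-I * ((u : ℂ) + (c : ℂ) * I) * ((x - a : ℝ) : ℂ)) := by
          rw [e]

/-! ## §2 The Dirichlet terms on the line `Im z = 1` -/

/-- RH-FREE.  `½ − i(u + i) = 3/2 − iu` as a real-part statement: `Re(½ − i(u+i)) = 3/2`. -/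
theorem re_half_sub_I_mul_line_one (u : ℝ) : ((1 : ℂ) / 2 - I * ((u : ℂ) + ((1 : ℝ) : ℂ) * I)).re = 3 / 2 := by
  rw [half_sub_I_mul_line_one]; simp

/-- RH-FREE.  The von Mangoldt Dirichlet term at `s = ½ − iz`, `n ≥ 1`: `Λ(n) n^{−s} = Λ(n) n^{−1/2} e^{iz log n}`. -/
theorem term_vonMangoldt_half_sub_eq {n : ℕ} (hn : n ≠ 0) (z : ℂ) :
    term ↗Λ (1 / 2 - I * z) n =
      ((ArithmeticFunction.vonMangoldt n : ℝ) : ℂ) * ((n : ℂ) ^ (-(1 / 2 : ℂ))) *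
        Complex.exp (I * z * ((Real.log n : ℝ) : ℂ)) := by
  rw [term_of_ne_zero hn]
  have hn' : (n : ℂ) ≠ 0 := by exact_mod_cast hn
  have hlog : Complex.log (n : ℂ) = ((Real.log n : ℝ) : ℂ) := by
    rw [← Complex.ofReal_natCast, Complex.ofReal_log (Nat.cast_nonneg n)]
  rw [div_eq_mul_inv, ← Complex.cpow_neg, neg_sub, show I * z - 1 / 2 = -(1 / 2 : ℂ) + I * z by ring,
    Complex.cpow_add _ _ hn', Complex.cpow_def_of_ne_zero hn' (I * z), hlog]
  ring_nf

/-- RH-FREE.  The norm of the von Mangoldt term on the line `Im z = 1` is the `σ = 3/2` norm: for every real `u`,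
`‖term Λ (½ − i(u+i)) n‖ = ‖term Λ (3/2) n‖`. -/
theorem norm_term_vonMangoldt_line_one (u : ℝ) (n : ℕ) :
    ‖term ↗Λ (1 / 2 - I * ((u : ℂ) + ((1 : ℝ) : ℂ) * I)) n‖ = ‖term ↗Λ (3 / 2 : ℂ) n‖ := by
  rw [norm_term_eq, norm_term_eq, re_half_sub_I_mul_line_one]
  norm_num

/-! ## §3 The prime part of the flow acts by prime shifts -/

/-- **RH-FREE · the prime part of the `θ`-flow generator acts by prime shifts**: for `θ > 1` and real `x`,
`invFourierLine (z ↦ L(Λ, ½ − iz) · Θ_θ(z)) 1 x = Σ' n, Λ(n) n^{−1/2} · invFourierLine Θ_θ 1 (x − log n)`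
(absolutely convergent on `Im z = 1`, where `|n^{−s}| = n^{−3/2}`). -/
theorem invFourierLine_vonMangoldt_mul_limTheta {θ : ℝ} (hθ : 1 < θ) (x : ℝ) :
    invFourierLine (fun z : ℂ => L ↗Λ (1 / 2 - I * z) * limTheta θ z) 1 x =
      ∑' n : ℕ, ((ArithmeticFunction.vonMangoldt n : ℝ) : ℂ) * ((n : ℂ) ^ (-(1 / 2 : ℂ))) *
        invFourierLine (limTheta θ) 1 (x - Real.log n) := by
  -- the summands of the line integral
  set F : ℕ → ℝ → ℂ := fun n u => term ↗Λ (1 / 2 - I * ((u : ℂ) + ((1 : ℝ) : ℂ) * I)) n *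
    (limTheta θ ((u : ℂ) + ((1 : ℝ) : ℂ) * I) * Complex.exp (-I * ((u : ℂ) + ((1 : ℝ) : ℂ) * I) * (x : ℂ))) with hF
  -- each summand is a constant multiple of the shifted kernel integrand
  have hFn : ∀ n : ℕ, ∀ u : ℝ, F n u =
      ((ArithmeticFunction.vonMangoldt n : ℝ) : ℂ) * ((n : ℂ) ^ (-(1 / 2 : ℂ))) *
        (limTheta θ ((u : ℂ) + ((1 : ℝ) : ℂ) * I) *
          Complex.exp (-I * ((u : ℂ) + ((1 : ℝ) : ℂ) * I) * ((x - Real.log n : ℝ) : ℂ))) := by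
    intro n u
    rcases eq_or_ne n 0 with rfl | hn
    · simp [hF]
    rw [hF]
    simp only
    rw [term_vonMangoldt_half_sub_eq hn]
    have e : Complex.exp (I * ((u : ℂ) + ((1 : ℝ) : ℂ) * I) * ((Real.log n : ℝ) : ℂ)) *
        Complex.exp (-I * ((u : ℂ) + ((1 : ℝ) : ℂ) * I) * (x : ℂ)) =
        Complex.exp (-I * ((u : ℂ) + ((1 : ℝ) : ℂ) * I) * ((x - Real.log n : ℝ) : ℂ)) := by
      rw [← Complex.exp_add]; congr 1; push_cast; ring
    rw [← e]
    ring
  -- integrability of each summand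
  have hI := integrable_limTheta_line hθ (b := 1) (by norm_num)
  have hF_int : ∀ n : ℕ, Integrable (F n) := by
    intro n
    have h := (integrable_limTheta_lineIntegrand hθ (b := 1) (by norm_num) (x - Real.log n)).const_mul
      (((ArithmeticFunction.vonMangoldt n : ℝ) : ℂ) * ((n : ℂ) ^ (-(1 / 2 : ℂ))))
    exact h.congr (Eventually.of_forall fun u => (hFn n u).symm)
  -- the norms: `∫‖F n‖ = ‖term Λ (3/2) n‖ · eˣ ∫‖Θ_θ(u+i)‖`
  set C : ℝ := Real.exp x * ∫ u : ℝ, ‖limTheta θ ((u : ℂ) + ((1 : ℝ) : ℂ) * I)‖ with hC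
  have hnormF : ∀ n : ℕ, ∀ u : ℝ, ‖F n u‖ =
      ‖term ↗Λ (3 / 2 : ℂ) n‖ * (Real.exp x * ‖limTheta θ ((u : ℂ) + ((1 : ℝ) : ℂ) * I)‖) := by
    intro n u
    rw [hF]
    simp only [norm_mul, norm_term_vonMangoldt_line_one, norm_cexp_line_one]
    ring
  have hint_norm : ∀ n : ℕ, ∫ u : ℝ, ‖F n u‖ = ‖term ↗Λ (3 / 2 : ℂ) n‖ * C := by
    intro n
    simp_rw [hnormF n]
    rw [integral_const_mul, hC, integral_const_mul]
  have hsum : Summable fun n : ℕ => ∫ u : ℝ, ‖F n u‖ := by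
    simp_rw [hint_norm]
    have hs : Summable fun n : ℕ => ‖term ↗Λ (3 / 2 : ℂ) n‖ :=
      (ArithmeticFunction.LSeriesSummable_vonMangoldt (s := (3 / 2 : ℂ)) (by norm_num)).norm
    exact hs.mul_right C
  -- swap sum and integral
  have hswap := integral_tsum_of_summable_integral_norm hF_int hsum
  -- assemble
  unfold invFourierLine
  have hlhs : (fun u : ℝ => L ↗Λ (1 / 2 - I * ((u : ℂ) + ((1 : ℝ) : ℂ) * I)) *
      limTheta θ ((u : ℂ) + ((1 : ℝ) : ℂ) * I) * Complex.exp (-I * ((u : ℂ) + ((1 : ℝ) : ℂ) * I) * (x : ℂ))) =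
      fun u : ℝ => ∑' n : ℕ, F n u := by
    funext u
    rw [hF, LSeries, mul_assoc, ← tsum_mul_right]
  rw [hlhs, ← hswap, ← tsum_mul_left]
  refine tsum_congr fun n => ?_
  have hFn' : (fun u : ℝ => F n u) = fun u : ℝ =>
      ((ArithmeticFunction.vonMangoldt n : ℝ) : ℂ) * ((n : ℂ) ^ (-(1 / 2 : ℂ))) *
        (limTheta θ ((u : ℂ) + ((1 : ℝ) : ℂ) * I) *
          Complex.exp (-I * ((u : ℂ) + ((1 : ℝ) : ℂ) * I) * ((x - Real.log n : ℝ) : ℂ))) := funext (hFn n)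
  rw [show (∫ u : ℝ, F n u) = ∫ u : ℝ, (fun u => F n u) u from rfl, hFn', integral_const_mul]
  ring

/-- **RH-FREE · real form**: for `θ > 1` and real `x`,
`Re invFourierLine (z ↦ L(Λ, ½ − iz) Θ_θ(z)) 1 x = Σ' n, Λ(n) n^{−1/2} K_θ(x − log n)` — the prime part of the
flow kernel `J_θ` is the prime-shift sum of `K_θ` (only `log n < x` contributes, [Su20] (K-iii)). -/
theorem re_invFourierLine_vonMangoldt_mul_limTheta {θ : ℝ} (hθ : 1 < θ) (x : ℝ) :
    (invFourierLine (fun z : ℂ => L ↗Λ (1 / 2 - I * z) * limTheta θ z) 1 x).re =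
      ∑' n : ℕ, ArithmeticFunction.vonMangoldt n * (n : ℝ) ^ (-(1 / 2 : ℝ)) * limKernel θ (x - Real.log n) := by
  rw [invFourierLine_vonMangoldt_mul_limTheta hθ x]
  -- the complex summands are real: `Λ(n) n^{-1/2} K_θ(x − log n)`
  have hterm : ∀ n : ℕ, ((ArithmeticFunction.vonMangoldt n : ℝ) : ℂ) * ((n : ℂ) ^ (-(1 / 2 : ℂ))) *
      invFourierLine (limTheta θ) 1 (x - Real.log n) =
      ((ArithmeticFunction.vonMangoldt n * (n : ℝ) ^ (-(1 / 2 : ℝ)) * limKernel θ (x - Real.log n) : ℝ) : ℂ) := by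
    intro n
    rw [← ofReal_limKernel]
    have hc : ((n : ℂ) ^ (-(1 / 2 : ℂ))) = (((n : ℝ) ^ (-(1 / 2 : ℝ)) : ℝ) : ℂ) := by
      rw [Complex.ofReal_cpow (Nat.cast_nonneg n)]
      push_cast
      rfl
    rw [hc]
    push_cast
    ring
  simp_rw [hterm]
  rw [← Complex.ofReal_tsum, Complex.ofReal_re]

end Summit.RiemannHypothesis.RiemannHypothesis.Theorems.SuzukiKernelSemigroup

end
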